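import Mathlib
import Literature.NumberTheory.NumberFields.PureCubicGenusDivisorLemmas
import Summits.QuantumAdvantage.QuantumAdvantage.Theorems.LinnikCubicClassGroupsPureCubicClassNumberHardStubFieldSetup
import HarnessLib

/-!
# Field set-up `L = K(ζ₃) ⊇ F = ℚ(ζ₃)` for a pure cubic field with a GENERAL radicand

Companion of `…PureCubicClassNumberHardStubFieldSetup.lean` (which treats `K ∋ ∛(pq)`, `p ≡ 2`,
`q ≡ 5 (mod 9)`): here `K ∋ α`, `α³ = m`, for any natural `m` and a prime `ℓ` with `3 ∤ v_ℓ(m)`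
(so `X³ − m` is irreducible and `K = ℚ(α)`, tree `Honda1971.adjoin_eq_top_of_not_dvd_padicValNat`).

* `isGalois_rat_of_isCyclotomicExtension_three_of_not_dvd_padicValNat` — `K(ζ₃)` is Galois over
  `ℚ` (splitting field of `(X³ − m)(X³ − 1)`);
* `exists_prime_pow_three_eq_span_of_not_dvd_padicValNat` — for a prime `p ≡ 2 (mod 3)` with
  `3 ∤ v_p(m)`: the unique prime `P ∋ p` of `L = K(ζ₃)`, `p𝓞_L = P³`, `e(P | P ∩ 𝓞_F) = 3`,
  `3 ∉ P ∩ 𝓞_F`, `#𝓞_F/(P ∩ 𝓞_F) = p²` (fundamental identity: `3 ∣ e` through `K`, `2 ∣ f`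
  through `F = ℚ(ζ₃)`, where `p` is inert);
* `fieldSetup_prime` — the bundle for a PRIME radicand `m = p ≡ 2 (mod 3)`: `[L:K] = 2`,
  `[L:ℚ] = 6`, `F = ℚ(ζ₃) ⊆ L` with `L/F` cyclic cubic, `𝓞_F` a PID with units `±ζ₃^i`, `F`
  totally complex, `θ = α ∈ L` with `[ℚ(θ):ℚ] = 3`, and the totally ramified prime `P ∋ p`.

HONEST FRAMING: infrastructure for Honda's criterion with prime radicand (a classical theorem
about class numbers of pure cubic fields), NOT summit progress.
-/

set_option linter.dupNamespace false

noncomputable section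

open Polynomial NumberField

open scoped Pointwise NumberField IntermediateField

namespace Summit.QuantumAdvantage.QuantumAdvantage.Theorems.LinnikCubicClassGroups

open Literature.NumberTheory.NumberFields

/-- **`K(ζ₃)` is Galois over `ℚ` for `K = ℚ(∛m)`** (`3 ∤ v_ℓ(m)` for some prime `ℓ`): it is the
splitting field over `ℚ` of `(X³ − m)(X³ − 1)`. [folklore] -/
theorem isGalois_rat_of_isCyclotomicExtension_three_of_not_dvd_padicValNat {ℓ m : ℕ}
    (hℓ : ℓ.Prime) (hm : ¬ 3 ∣ padicValNat ℓ m) {K : Type*} [Field K] [NumberField K]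
    (hK : Module.finrank ℚ K = 3) {α : K} (hα : α ^ 3 = (m : K)) (L : Type*) [Field L]
    [NumberField L] [Algebra K L] [IsCyclotomicExtension {3} K L] : IsGalois ℚ L := by
  obtain ⟨ζ, hζ⟩ : ∃ ζ : L, IsPrimitiveRoot ζ 3 := ⟨_, IsCyclotomicExtension.zeta_spec 3 K L⟩
  obtain ⟨θ, hθdef⟩ : ∃ θ : L, θ = algebraMap K L α := ⟨_, rfl⟩
  have hθ : θ ^ 3 = (m : L) := by rw [hθdef, ← map_pow, hα, map_natCast]
  obtain ⟨f, hfdef⟩ : ∃ f : ℚ[X], f = (X ^ 3 - C (m : ℚ)) * (X ^ 3 - C 1) := ⟨_, rfl⟩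
  have hfmonic : f.Monic :=
    hfdef ▸ (monic_X_pow_sub_C _ three_ne_zero).mul (monic_X_pow_sub_C _ three_ne_zero)
  have hsplit : (f.map (algebraMap ℚ L)).Splits := by
    rw [hfdef, Polynomial.map_mul]
    refine Splits.mul ?_ ?_
    · have h1 : (X ^ 3 - C (m : ℚ)).map (algebraMap ℚ L) = X ^ 3 - C (m : L) := by
        simp [Polynomial.map_sub, Polynomial.map_pow]
      rw [h1]
      exact X_pow_sub_C_splits_of_isPrimitiveRoot hζ hθ
    · have h1 : (X ^ 3 - C (1 : ℚ)).map (algebraMap ℚ L) = X ^ 3 - C (1 : L) := by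
        simp [Polynomial.map_sub, Polynomial.map_pow]
      rw [h1]
      exact X_pow_sub_C_splits_of_isPrimitiveRoot hζ (one_pow 3)
  have hθroot : θ ∈ f.rootSet L := hfmonic.mem_rootSet.mpr (by simp [hfdef, hθ])
  have hζroot : ζ ∈ f.rootSet L := hfmonic.mem_rootSet.mpr (by simp [hfdef, hζ.pow_eq_one])
  have htop : IntermediateField.adjoin ℚ (f.rootSet L) = ⊤ := by
    have hθE : θ ∈ IntermediateField.adjoin ℚ (f.rootSet L) :=
      IntermediateField.subset_adjoin ℚ _ hθroot
    have hζE : ζ ∈ IntermediateField.adjoin ℚ (f.rootSet L) :=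
      IntermediateField.subset_adjoin ℚ _ hζroot
    have hKE : ∀ k : K, algebraMap K L k ∈ IntermediateField.adjoin ℚ (f.rootSet L) := by
      intro k
      have hk : k ∈ IntermediateField.adjoin ℚ {α} := by
        rw [Honda1971.adjoin_eq_top_of_not_dvd_padicValNat hℓ hm hK hα]
        exact IntermediateField.mem_top
      have hk' : algebraMap K L k ∈
          (IntermediateField.adjoin ℚ {α}).map (IsScalarTower.toAlgHom ℚ K L) :=
        (IntermediateField.mem_map _).mpr ⟨k, hk, rfl⟩
      rw [IntermediateField.adjoin_map, Set.image_singleton, IsScalarTower.coe_toAlgHom',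
        ← hθdef] at hk'
      exact IntermediateField.adjoin_le_iff.mpr (Set.singleton_subset_iff.mpr hθE) hk'
    rw [eq_top_iff]
    rintro x -
    have hx : x ∈ Algebra.adjoin K ({ζ} : Set L) := by
      rw [IsCyclotomicExtension.adjoin_primitive_root_eq_top hζ]
      exact Algebra.mem_top
    induction hx using Algebra.adjoin_induction with
    | mem x hx =>
      rw [Set.mem_singleton_iff] at hx
      rw [hx]
      exact hζE
    | algebraMap r => exact hKE r
    | add x y _ _ hx hy => exact add_mem hx hy
    | mul x y _ _ hx hy => exact mul_mem hx hy
  haveI : f.IsSplittingField ℚ L := isSplittingField_iff_intermediateField.mpr ⟨hsplit, htop⟩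
  haveI : Normal ℚ L := Normal.of_isSplittingField f
  exact { to_isSeparable := inferInstance, to_normal := inferInstance }

/-- **Total ramification in `L = K(ζ₃)` of a prime `p ≡ 2 (mod 3)` with `3 ∤ v_p(m)`.**  Let
`K ∋ α` be cubic with `α³ = m`, `L ⊇ K` a sextic number field and `F ⊆ L` a copy of `ℚ(ζ₃)`.
Then there is a maximal ideal `P ∋ p` of `𝓞 L` with `p𝓞_L = P³`, `e(P | P ∩ 𝓞_F) = 3`,
`3 ∉ P ∩ 𝓞_F` and `#(𝓞_F / P ∩ 𝓞_F) = p²` (fundamental identity `∑ e f = 6` over the primes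
above `p`: `3 ∣ e` through `K` — `p` is totally ramified in `K`, tree
`Honda1971.ramificationIdx_eq_three_of_not_dvd_padicValNat` — and `2 ∣ f` through `F`, where
`p ≡ 2 (mod 3)` is inert; so there is a single prime, with `e = 3`, `f = 2`). [folklore] -/
theorem exists_prime_pow_three_eq_span_of_not_dvd_padicValNat {K L : Type*} [Field K]
    [NumberField K] [Field L] [NumberField L] [Algebra K L] (F : IntermediateField ℚ L)
    [IsCyclotomicExtension {3} ℚ F] (hL6 : Module.finrank ℚ L = 6) {p m : ℕ} (hp : p.Prime)
    (hm : ¬ 3 ∣ padicValNat p m) (hp3 : p % 3 = 2) (hK : Module.finrank ℚ K = 3) {α : K}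
    (hα : α ^ 3 = (m : K)) :
    ∃ P : Ideal (𝓞 L), P.IsMaximal ∧ (p : 𝓞 L) ∈ P ∧ Ideal.span {(p : 𝓞 L)} = P ^ 3 ∧
      P.ramificationIdx (𝓞 F) = 3 ∧ (3 : 𝓞 F) ∉ P.under (𝓞 F) ∧
      Nat.card ((𝓞 F) ⧸ P.under (𝓞 F)) = p ^ 2 := by
  haveI : Fact p.Prime := ⟨hp⟩
  obtain ⟨𝔭, h𝔭def⟩ : ∃ 𝔭 : Ideal ℤ, 𝔭 = Ideal.span {(p : ℤ)} := ⟨_, rfl⟩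
  haveI h𝔭max : 𝔭.IsMaximal := h𝔭def ▸
    Ideal.IsPrime.isMaximal
      ((Ideal.span_singleton_prime (by exact_mod_cast hp.ne_zero)).mpr
        (Nat.prime_iff_prime_int.mp hp)) (by simpa using hp.ne_zero)
  have h𝔭0 : 𝔭 ≠ ⊥ := by
    rw [h𝔭def, Ne, Ideal.span_singleton_eq_bot]
    exact_mod_cast hp.ne_zero
  have hmem : ∀ (Q : Ideal (𝓞 L)) [Q.LiesOver 𝔭], (p : 𝓞 L) ∈ Q := by
    intro Q _
    have h1 : ((p : ℕ) : ℤ) ∈ Q.under ℤ := by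
      rw [← Ideal.over_def Q 𝔭, h𝔭def]
      exact Ideal.mem_span_singleton_self _
    rw [Ideal.under_def, Ideal.mem_comap, map_natCast] at h1
    exact h1
  have he : ∀ (Q : Ideal (𝓞 L)) [Q.IsMaximal] [Q.LiesOver 𝔭],
      Q.ramificationIdx ℤ = 3 * Q.ramificationIdx (𝓞 K) := by
    intro Q _ _
    haveI : (Q.under (𝓞 K)).IsMaximal := Ideal.IsMaximal.under _ Q
    have hne : Q.under (𝓞 K) ≠ ⊥ := Ideal.IsMaximal.ne_bot_of_isIntegral_int _
    let v : IsDedekindDomain.HeightOneSpectrum (𝓞 K) :=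
      ⟨Q.under (𝓞 K), Ideal.IsMaximal.isPrime inferInstance, hne⟩
    have hpv : (p : 𝓞 K) ∈ v.asIdeal := by
      change (p : 𝓞 K) ∈ Q.under (𝓞 K)
      rw [Ideal.under_def, Ideal.mem_comap, map_natCast]
      exact hmem Q
    have h3 : (Q.under (𝓞 K)).ramificationIdx ℤ = 3 :=
      Honda1971.ramificationIdx_eq_three_of_not_dvd_padicValNat hp hm hK hα v hpv
    rw [Ideal.ramificationIdx_tower (R := ℤ) (Q.under (𝓞 K)) Q, h3]
  have hp3' : ¬ p ∣ 3 := fun h => by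
    have := (Nat.prime_dvd_prime_iff_eq hp Nat.prime_three).mp h
    omega
  have hord : orderOf (p : ZMod 3) = 2 := by
    haveI : Fact (Nat.Prime 2) := ⟨Nat.prime_two⟩
    have hcast : (p : ZMod 3) = 2 := by
      rw [← ZMod.natCast_mod, hp3]
      rfl
    rw [hcast]
    exact orderOf_eq_prime (by decide) (by decide)
  have hfF : ∀ (Q : Ideal (𝓞 L)) [Q.IsMaximal] [Q.LiesOver 𝔭],
      (Q.under (𝓞 F)).inertiaDeg ℤ = 2 := by
    intro Q _ _
    haveI : (Q.under (𝓞 F)).LiesOver (Ideal.span {(p : ℤ)}) := h𝔭def ▸ inferInstance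
    rw [IsCyclotomicExtension.Rat.inertiaDeg_eq_of_not_dvd p F (Q.under (𝓞 F)) hp3', hord]
  have hf : ∀ (Q : Ideal (𝓞 L)) [Q.IsMaximal] [Q.LiesOver 𝔭],
      Q.inertiaDeg ℤ = 2 * Q.inertiaDeg (𝓞 F) := by
    intro Q _ _
    rw [Ideal.inertiaDeg_tower (R := ℤ) (Q.under (𝓞 F)) Q, hfF Q]
  have hge : ∀ Q : 𝔭.primesOver (𝓞 L), 6 ≤ Q.1.ramificationIdx ℤ * Q.1.inertiaDeg ℤ := by
    rintro ⟨Q, hQp, hQl⟩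
    haveI : Q.IsMaximal := Ideal.IsMaximal.of_liesOver_isMaximal Q 𝔭
    have h1 := he Q
    have h2 := hf Q
    have h3 : 0 < Q.ramificationIdx (𝓞 K) := Ideal.ramificationIdx_pos _ _
    have h4 : 0 < Q.inertiaDeg (𝓞 F) := Ideal.inertiaDeg_pos _ _
    change 6 ≤ Q.ramificationIdx ℤ * Q.inertiaDeg ℤ
    rw [h1, h2]
    nlinarith
  obtain ⟨P, hPmax, hPover⟩ := Ideal.exists_maximal_ideal_liesOver_of_isIntegral (S := 𝓞 L) 𝔭
  have hsum := Ideal.sum_ramification_inertia_eq_finrank 𝔭 (𝓞 L)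
  rw [RingOfIntegers.rank, hL6] at hsum
  let P' : 𝔭.primesOver (𝓞 L) := ⟨P, hPmax.isPrime, hPover⟩
  have huniq : ∀ Q : 𝔭.primesOver (𝓞 L), Q = P' := by
    intro Q
    by_contra hne
    have h2 : ∑ x ∈ ({Q, P'} : Finset (𝔭.primesOver (𝓞 L))),
        x.1.ramificationIdx ℤ * x.1.inertiaDeg ℤ ≤ 6 := by
      rw [← hsum]
      exact Finset.sum_le_sum_of_subset (Finset.subset_univ _)
    rw [Finset.sum_pair hne] at h2
    have := hge Q
    have := hge P'
    omega
  have hPef : P.ramificationIdx ℤ * P.inertiaDeg ℤ = 6 := by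
    rw [← hsum]
    haveI : Subsingleton (𝔭.primesOver (𝓞 L)) := ⟨fun a b => (huniq a).trans (huniq b).symm⟩
    exact (Fintype.sum_subsingleton
      (fun x : 𝔭.primesOver (𝓞 L) => x.1.ramificationIdx ℤ * x.1.inertiaDeg ℤ) P').symm
  have heP : P.ramificationIdx ℤ = 3 := by
    have h1 := he P
    have h2 := hf P
    have h3 : 0 < P.ramificationIdx (𝓞 K) := Ideal.ramificationIdx_pos _ _
    have h4 : 0 < P.inertiaDeg (𝓞 F) := Ideal.inertiaDeg_pos _ _
    rw [h1, h2] at hPef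
    have h5 : P.ramificationIdx (𝓞 K) ≤ 1 := by nlinarith
    rw [h1]
    omega
  refine ⟨P, hPmax, hmem P, ?_, ?_, ?_, ?_⟩
  · have hI : Ideal.span {(p : 𝓞 L)} = 𝔭.map (algebraMap ℤ (𝓞 L)) := by
      rw [h𝔭def, Ideal.map_span, Set.image_singleton, map_natCast]
    have hI0 : 𝔭.map (algebraMap ℤ (𝓞 L)) ≠ ⊥ := by
      rw [← hI, Ne, Ideal.span_singleton_eq_bot]
      exact_mod_cast hp.ne_zero
    have hcount := Ideal.IsDedekindDomain.ramificationIdx_eq_normalizedFactors_count 𝔭 P hI0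
    have hall : ∀ Q ∈ UniqueFactorizationMonoid.normalizedFactors (𝔭.map (algebraMap ℤ (𝓞 L))),
        Q = P := by
      intro Q hQ
      have hQ' : Q ∈ 𝔭.primesOver (𝓞 L) := by
        rw [← IsDedekindDomain.coe_primesOverFinset h𝔭0 (𝓞 L), Finset.mem_coe,
          Multiset.mem_toFinset, UniqueFactorizationMonoid.factors_eq_normalizedFactors]
        exact hQ
      exact congrArg Subtype.val (huniq ⟨Q, hQ'⟩)
    have hnf : UniqueFactorizationMonoid.normalizedFactors (𝔭.map (algebraMap ℤ (𝓞 L))) =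
        Multiset.replicate 3 P := by
      have h := Multiset.eq_replicate_card.mpr hall
      rw [h, Multiset.count_replicate_self, heP] at hcount
      rw [h, ← hcount]
    rw [hI, ← Ideal.prod_normalizedFactors_eq_self hI0, hnf, Multiset.prod_replicate]
  · have ht := Ideal.ramificationIdx_tower (R := ℤ) (P.under (𝓞 F)) P
    haveI : (P.under (𝓞 F)).LiesOver (Ideal.span {(p : ℤ)}) := h𝔭def ▸ inferInstance
    rw [heP, IsCyclotomicExtension.Rat.ramificationIdx_eq_of_not_dvd p F (P.under (𝓞 F)) hp3',
      one_mul] at ht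
    exact ht.symm
  · intro h3
    haveI : (P.under (𝓞 F)).IsMaximal := Ideal.IsMaximal.under _ P
    have hpF : (p : 𝓞 F) ∈ P.under (𝓞 F) := by
      rw [Ideal.under_def, Ideal.mem_comap, map_natCast]
      exact hmem P
    have hcop : IsCoprime (p : 𝓞 F) (3 : 𝓞 F) := by
      have h' : IsCoprime (p : ℤ) (3 : ℤ) :=
        Nat.isCoprime_iff_coprime.mpr ((Nat.coprime_primes hp Nat.prime_three).mpr (by omega))
      simpa using h'.map (Int.castRingHom (𝓞 F))
    obtain ⟨a, b, hab⟩ := hcop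
    exact (Ideal.IsMaximal.ne_top inferInstance) ((Ideal.eq_top_iff_one _).mpr
      (hab ▸ (P.under (𝓞 F)).add_mem ((P.under (𝓞 F)).mul_mem_left a hpF)
        ((P.under (𝓞 F)).mul_mem_left b h3)))
  · haveI : (P.under (𝓞 F)).LiesOver (Ideal.span {(p : ℤ)}) := h𝔭def ▸ inferInstance
    rw [← Submodule.cardQuot_apply, ← Ideal.absNorm_apply, ← Ideal.pow_inertiaDeg p (P.under (𝓞 F)),
      hfF P]

/-- **Field set-up for a PRIME radicand `p ≡ 2 (mod 3)`.**  For a cubic number field `K ∋ α`,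
`α³ = p`, and any `{3}`-cyclotomic extension `L` of `K`: `[L:K] = 2`, `[L:ℚ] = 6`, `L/ℚ` Galois,
the subfield `F = ℚ(ζ₃)` (`[F:ℚ] = 2`, `L/F` cyclic cubic, `𝓞_F` a PID, `F` totally complex, units
`±ζ₃^i` with `ζ₃² + ζ₃ + 1 = 0` in `𝓞_F`), `θ = α ∈ L` with `[ℚ(θ):ℚ] = 3`, and the totally
ramified prime `P ∋ p` (`p𝓞_L = P³`, `e(P | P ∩ 𝓞_F) = 3`, `3 ∉ P ∩ 𝓞_F`,
`#𝓞_F/(P ∩ 𝓞_F) = p²`). [folklore] -/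
theorem fieldSetup_prime {p : ℕ} (hp : p.Prime) (hp3 : p % 3 = 2) (K : Type*) [Field K]
    [NumberField K] (hK : Module.finrank ℚ K = 3) {α : K} (hα : α ^ 3 = (p : K))
    (L : Type*) [Field L] [NumberField L] [Algebra K L] [IsCyclotomicExtension {3} K L] :
    Module.finrank K L = 2 ∧ Module.finrank ℚ L = 6 ∧ IsGalois ℚ L ∧
      ∃ F : IntermediateField ℚ L,
        IsGalois F L ∧ Module.finrank F L = 3 ∧ Module.finrank ℚ F = 2 ∧
        (∃ σ : L ≃ₐ[F] L, ∀ τ : L ≃ₐ[F] L, τ ∈ Subgroup.zpowers σ) ∧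
        IsPrincipalIdealRing (𝓞 F) ∧
        (∀ v : NumberField.InfinitePlace F, v.IsComplex) ∧
        (∃ θ : L, θ ^ 3 = (p : L) ∧ Module.finrank ℚ ℚ⟮θ⟯ = 3) ∧
        ∃ ζ : (𝓞 F)ˣ, ((ζ : 𝓞 F) : F) ^ 3 = 1 ∧ ((ζ : 𝓞 F) : F) ≠ 1 ∧
          (ζ : 𝓞 F) ^ 2 + (ζ : 𝓞 F) + 1 = 0 ∧
          (∀ w : (𝓞 F)ˣ, ∃ i : ℕ, w = ζ ^ i ∨ w = -ζ ^ i) ∧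
          ∃ P : Ideal (𝓞 L), P.IsMaximal ∧ (p : 𝓞 L) ∈ P ∧
            Ideal.span {(p : 𝓞 L)} = P ^ 3 ∧
            P.ramificationIdx (𝓞 F) = 3 ∧
            (3 : 𝓞 F) ∉ P.under (𝓞 F) ∧
            Nat.card ((𝓞 F) ⧸ P.under (𝓞 F)) = p ^ 2 := by
  haveI : Fact p.Prime := ⟨hp⟩
  have hvp : ¬ 3 ∣ padicValNat p p := by rw [padicValNat_self]; decide
  have hKL : Module.finrank K L = 2 := by
    rw [IsCyclotomicExtension.finrank L (irreducible_cyclotomic_three_of_finrank_eq_three hK),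
      Nat.totient_prime Nat.prime_three]
  have hL6 : Module.finrank ℚ L = 6 := by
    rw [← Module.finrank_mul_finrank ℚ K L, hK, hKL]
  obtain ⟨ζ, hζ⟩ : ∃ ζ : L, IsPrimitiveRoot ζ 3 := ⟨_, IsCyclotomicExtension.zeta_spec 3 K L⟩
  haveI hGal : IsGalois ℚ L :=
    isGalois_rat_of_isCyclotomicExtension_three_of_not_dvd_padicValNat hp hvp hK hα L
  haveI hF : IsCyclotomicExtension {3} ℚ ℚ⟮ζ⟯ :=
    hζ.intermediateField_adjoin_isCyclotomicExtension ℚ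
  have hF2 : Module.finrank ℚ ℚ⟮ζ⟯ = 2 := by
    rw [IsCyclotomicExtension.finrank (n := 3) ℚ⟮ζ⟯ (cyclotomic.irreducible_rat (by norm_num)),
      Nat.totient_prime Nat.prime_three]
  have hFL : Module.finrank ℚ⟮ζ⟯ L = 3 := by
    have h := Module.finrank_mul_finrank ℚ ℚ⟮ζ⟯ L
    rw [hF2, hL6] at h
    omega
  -- `θ = α ∈ L`, `[ℚ(θ):ℚ] = 3`
  have hθ : ∃ θ : L, θ ^ 3 = (p : L) ∧ Module.finrank ℚ ℚ⟮θ⟯ = 3 := by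
    refine ⟨algebraMap K L α, by rw [← map_pow, hα, map_natCast], ?_⟩
    have hθ3 : (algebraMap K L α) ^ 3 = (p : L) := by rw [← map_pow, hα, map_natCast]
    have hint : IsIntegral ℚ (algebraMap K L α) := .of_finite ℚ _
    rw [IntermediateField.adjoin.finrank hint,
      Honda1971.minpoly_eq_of_not_dvd_padicValNat hp hvp hθ3, natDegree_X_pow_sub_C]
  refine ⟨hKL, hL6, hGal, ℚ⟮ζ⟯, inferInstance, hFL, hF2, ?_, IsCyclotomicExtension.Rat.three_pid ℚ⟮ζ⟯,
    (IsCyclotomicExtension.Rat.isTotallyComplex ℚ⟮ζ⟯ (n := 3) (by norm_num)).isComplex, hθ, ?_⟩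
  · haveI : Fact (Nat.Prime 3) := ⟨Nat.prime_three⟩
    haveI : IsCyclic (L ≃ₐ[ℚ⟮ζ⟯] L) :=
      isCyclic_of_prime_card (p := 3) (by rw [IsGalois.card_aut_eq_finrank, hFL])
    exact IsCyclic.exists_generator
  have hζF : IsPrimitiveRoot (⟨ζ, IntermediateField.mem_adjoin_simple_self ℚ ζ⟩ : ℚ⟮ζ⟯) 3 :=
    IsPrimitiveRoot.coe_submonoidClass_iff.mp hζ
  obtain ⟨η, hη, hunits⟩ := exists_units_eq_pow_or_neg_pow hζF
  refine ⟨η, ?_, ?_, ?_, hunits, ?_⟩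
  · rw [hη]
    exact hζF.pow_eq_one
  · rw [hη]
    exact hζF.ne_one (by norm_num)
  · -- `ζ² + ζ + 1 = 0` in `𝓞 F`
    have h3 := hζF.pow_eq_one
    have h1 := hζF.ne_one (by norm_num)
    rw [← hη] at h3 h1
    have hfac : (((η : 𝓞 ℚ⟮ζ⟯) : ℚ⟮ζ⟯) - 1) *
        (((η : 𝓞 ℚ⟮ζ⟯) : ℚ⟮ζ⟯) ^ 2 + ((η : 𝓞 ℚ⟮ζ⟯) : ℚ⟮ζ⟯) + 1) = 0 := by
      linear_combination h3
    have hF' : ((η : 𝓞 ℚ⟮ζ⟯) : ℚ⟮ζ⟯) ^ 2 + ((η : 𝓞 ℚ⟮ζ⟯) : ℚ⟮ζ⟯) + 1 = 0 := by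
      rcases mul_eq_zero.mp hfac with h | h
      · exact absurd (sub_eq_zero.mp h) h1
      · exact h
    apply RingOfIntegers.coe_injective
    push_cast
    exact hF'
  obtain ⟨P, hP, hpP, hspan, he, h3, hcard⟩ :=
    exists_prime_pow_three_eq_span_of_not_dvd_padicValNat ℚ⟮ζ⟯ hL6 hp hvp hp3 hK hα
  exact ⟨P, hP, hpP, hspan, he, h3, hcard⟩

end Summit.QuantumAdvantage.QuantumAdvantage.Theorems.LinnikCubicClassGroups

end
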